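import Summits.QuantumFields.YangMills.Theorems.BalabanUVNodesN11ChargedSepJunctionOfSolvable
import Summits.QuantumFields.YangMills.Theorems.BalabanUVNodesN11RePinnedParamDefs

/-!
# DAG node N11 — 12a″'s READING-REGION LAW `RegOn` IS A THEOREM AT THE RE-PINNED PARAMETER `rePinH θ`, on the selector the 𝐓-step reads, FROM K0's PER-CUBE
# [15]-SOLVABILITY AT EVERY LEVEL (the row `hreg` of the no-expansion 𝐓-step faces DISCHARGED at this seat's A6 inhabitant)

HEADER — WORK-UNIT METADATA.  Cell `pub-ymgap`, YM-PLAN Track A (HUMAN RULING D-0062), seat `pub-ymgap-dag-n11-d` (g13; R134 fan-out seat N11 [B14], strategy s2),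
route `BalabanUVNodes`, item K1⁷ `StabilityBAtRecordR13SepCoPH` = stmt-QuantumFields-20542 (helper, `--kind proof --supports 20542 --as helper`, count-neutral).
[III] = [Balaban1988Convergent], [15] = [Balaban1985Variational], [B7] = [Balaban1985Averaging].  Over this seat's g9 `…N11HistoryPinnedResidualDefs` (`ZhPinOfRecord₁₃`, `histPinOfRecord₁₃`,
`IsNoExpHistAt`, `isNoExpHistAt_restrict`) ∕ `…N11RePinnedParamDefs` (`rePinH`, `zhAt_rePinH`), node00-def-K0a's `Node00/Record13ResidualsR` (`ZrOfRecord₁₃_ζ0_of_ne_of_ne`), 12a″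
`Node00/TkWeightsOfRecordP` (`TkResidualW.RegOn`, `readSelOfSeq`), g12's `…N11ChiTopRegularity` (★★★★ `plaqSmallOn_genSet_top_of_chiSeqOfRecord_ne_zero_of_solvable`),
r14 `B14Eq218SeqSucc` (`Seq.restrict`, `Seq.init`), def-R's `suppDomOfRecord` ∕ dag-n11-e's `B14SeparationOfRecord.mem_hullD_iff`.

WHY THIS FILE.  The no-expansion 𝐓-step faces (p595777 → g13's `…ChargedSepJunction(OfSolvable)Fibre`) display 12a″'s law `hreg : ∀ s₀, (θ.zhAt p s₀).RegOn … (Γr s₀)` — «a non-zero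
`ζ0_j(Y)(ω)` forces `(ω j).1` regular on the reading region `Γr j Y`» — for EVERY `j, Y, ω`, to be discharged «by whoever pins the residual».  The pins in the tree (K0a's
`ZrOfRecord₁₃`, this seat's history-indexed `ZhPinOfRecord₁₃` behind `rePinH θ`) carry `ζ0_j(T) ≡ 1` at generations `j ≥ 1` off the no-expansion histories, so `RegOn` on print's
selector `readSelOfSeq` (EVERY `Y`, in particular `Y = T`) is FALSE at them (LOCATED: the row as displayed over all region labels is not met by any pin of record).  But the
𝐓-step evaluates `ζ_j` only at its own region argument `Y = (Ω_{j+1}(s₀))ᶜ`, `j < k`: there the certificate family either VANISHES (expansion at step `j+1`: `Y ∉ {T, ∅}`) or is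
the pin value `χ_j(first j pairs)(V_j)·w_j`, whose non-vanishing puts `V_j` in the χ-support — and then g12's top clause (per-cube [15]-solvability + cube cover + numerics) makes
`V_j` `2ε_j ≤ cR·ε_j`-regular on the plaquettes touching `Ω_j^{(j)} ⊇` the reading region; at `j = 0` a no-expansion first step has `Ω₁ = ∅`, so the support domain and the reading
region are EMPTY.  Hence `RegOn` HOLDS at `rePinH θ` on the CUT selector «print's reading region at `(j, (Ω_{j+1})ᶜ)`, `j < k`; `∅` elsewhere» — which the faces accept as `Γr`
(any selector) and which feeds the junction verbatim (`sep_setOf_eq_of`).  The sequel `…N11NoExpansionTStepRePinnedOfSolvable` cashes this in.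

WHAT THIS FILE PROVES (0 `sorry`, 0 `def`).
* §1 `plaqSmallOn_plaqsOf_pts_sep_of_not`, `sep_setOf_eq_of`, `plaqSmallOn_plaqsOf_pts_empty`, `suppDomOfRecord_eq_empty_of_Ω_one` (the cut selector's bookkeeping; `hullD` of `∅`).
* §2 `WtOfRecord₁₃H_rePinH_ζ` (`rfl`); ★ `WtOfRecord₁₃H_rePinH_ζ_eq_zero_of_ne` (at an expansion generation the weight of record VANISHES at `rePinH θ`); ★
  `chiSeqOfRecord_ne_zero_of_WtOfRecord₁₃H_rePinH_ζ_ne_zero` (at a no-expansion generation a non-zero weight charges `χ_j` of the first `j` pairs).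
* §3 ★★★ `regOn_rePinH_cutSel_of_solvable` — `((rePinH θ).zhAt p s₀).RegOn … θ.s2.cR … (cut selector of s₀)` for every history `s₀` of length `k ≤ K` (`k ≤ m + K`, `2 ≤ cR`,
  `1 ≤ M₁`) from: per-cube [15]-solvability inside `χ_j`, the cover of `Ω_j` by the χ-cubes it contains, and the numerics — at every level `1 ≤ j ≤ k` (K0 ∕ def-R rows).

HONEST FRAMING.  Helper lane of K1⁷; bookkeeping over tree theorems; nothing of [III] ∕ [15] ∕ [B7] asserted (solvability, cover, numerics are HYPOTHESES).  LOCATED (above):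
`RegOn` over ALL region labels is unsatisfiable at the pins of record; the cut selector is the repair inside the faces' own quantifier.  N11 NOT discharged; K1⁷ NOT closed;
counts unmoved (typed 28∕28 · discharged 5∕27).  One finite four-torus programme at fixed `ε = L^{−K}` — NOT ℝ⁴, NOT OS, NOT a mass gap, NOT Clay.  No `sorry`, `axiom`, `def`,
`instance`, `notation`.  Sources (SHAPE only): [III] (2.2) p.255, (2.10) p.256, (2.16)–(2.18) p.257, (2.21) p.258, p.267, (3.16)–(3.20) pp.268–269, (3.24) p.270; [15] Thm 1 (7)–(8)
pp.278–279; [B7] Prop. 2 p.26.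
-/

noncomputable section

open MeasureTheory
open scoped BigOperators ENNReal NNReal Matrix.Norms.L2Operator

namespace Summit.QuantumFields.YangMills.Theorems.BalabanUVNodesN11ReadRegRePinned

open Literature.MathematicalPhysics.QuantumFieldTheory.Balaban1983to89 T4Continuum T4NestedCovariance Node00 Node00.Tk DagBinding
open B15DeterminingSets B8Eq17ClassAkV1 B14.Eq218Concrete B10Eq42TorusConstraint
open B14.Eq213MaximalDomains (side)
open B14.Eq213DetSet (Bj)
open Literature.MathematicalPhysics.QuantumFieldTheory.BalabanImbrieJaffe1984to88.BIJ85Eq453GaugeField (qsstarGIter0)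
open B14SeparationOfRecord (mem_hullD_iff)
open BalabanUVNodesN11ChiTopRegularity (plaqSmallOn_genSet_top_of_chiSeqOfRecord_ne_zero_of_solvable)
open BalabanUVNodesN11HistoryPinnedResidualDefs BalabanUVNodesN11RePinnedParamDefs

variable {F : T4Family} {N : ℕ} [NeZero N]

/-! ## §1  The cut reading selector: print's reading regions at the T-step's own region arguments, nothing elsewhere -/

/-- **PLAQUETTES TOUCHING A CUT REGION**: if the cut condition fails the region is empty and no plaquette touches it. [cite: Balaban1988Convergent, (2.2) p.255 (bookkeeping)] -/
theorem plaqSmallOn_plaqsOf_pts_sep_of_not {K : ℕ} {c : Prop} (hc : ¬ c) (R : Set (Site (F.P K) 0)) (j : ℕ) (δ : ℝ) (U : GaugeField (F.P K) j (SU N)) :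
    PlaqSmallOn (plaqsOf (pts j {x | c ∧ x ∈ R})) δ U := by
  intro q hq
  rcases hq with h | h | h | h <;> exact absurd (mem_pts.1 h).1 hc

/-- If the cut condition holds the cut region is the region. [cite: Balaban1988Convergent, (2.2) p.255 (bookkeeping)] -/
theorem sep_setOf_eq_of {K : ℕ} {c : Prop} (hc : c) (R : Set (Site (F.P K) 0)) : {x | c ∧ x ∈ R} = R :=
  Set.ext fun _ => ⟨fun h => h.2, fun h => ⟨hc, h⟩⟩

/-- No plaquette touches the empty region. [cite: Balaban1988Convergent, (2.2) p.255 (bookkeeping)] -/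
theorem plaqSmallOn_plaqsOf_pts_empty {K : ℕ} (j : ℕ) (δ : ℝ) (U : GaugeField (F.P K) j (SU N)) : PlaqSmallOn (plaqsOf (pts j (∅ : Set (Site (F.P K) 0)))) δ U := by
  intro q hq
  rcases hq with h | h | h | h <;> exact absurd (mem_pts.1 h) (Set.notMem_empty _)

/-- The support domain of an index without first region is empty (`hullD` of `∅`). [cite: Balaban1988Convergent, p.255 (bookkeeping)] -/
theorem suppDomOfRecord_eq_empty_of_Ω_one (ν : Stage7Numerics) (K : ℕ) (Ω : ℕ → Set (Site (F.P K) 0)) (h : Ω 1 = ∅) :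
    suppDomOfRecord F ν K Ω = ∅ := by
  ext x
  simp only [Set.mem_empty_iff_false, iff_false]
  intro hx
  obtain ⟨a, -, hne, -⟩ := mem_hullD_iff.1 hx
  rw [h, Set.inter_empty] at hne
  exact Set.not_nonempty_empty hne

/-! ## §2  At the re-pinned parameter the generation weights of record charge only no-expansion generations, and there the old front factor is non-zero -/

section RePin

variable (θ : Stage13HParams F N) (p : B12.RunParams)

/-- **THE GENERATION-`j` WEIGHT OF RECORD AT THE RE-PINNED PARAMETER IS THE CERTIFICATE FAMILY'S `ζ0_j`** (`rfl` chain `WtOfRecord₁₃H` → 12a″ `zetaWtP` → `zhAt_rePinH`).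
[cite: Balaban1988Convergent, (2.21) p.258, (3.16) p.268 (bookkeeping)] -/
theorem WtOfRecord₁₃H_rePinH_ζ {n : ℕ} (s : SeqOfRecord F θ.ν θ.τ9.M (gOfRecord₁₃ F N θ.toStage13Params p) p.K n) (j : ℕ) (Y : Set (Site (F.P p.K) 0))
    (ω : MultiCfg (F.P p.K) (SU N) (FluctV N)) :
    (WtOfRecord₁₃H F N (rePinH θ) p s).ζ j Y ω = (ZhPinOfRecord₁₃ θ.toStage13Params p s.Ω s.Λ).ζ0 j Y ω := rfl

/-- **AT AN EXPANSION GENERATION THE WEIGHT OF RECORD VANISHES** at the re-pinned parameter: if `Ω_{j+1}(s) ≠ ∅, ≠ T` (`j < K`), then `ζ_j((Ω_{j+1})ᶜ) = 0` — the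
region label is neither `T` nor `∅`, where both the certificate family (at a no-expansion history) and K0a's run-indexed residual (elsewhere) vanish by fiat.
[cite: Balaban1988Convergent, p.267, (3.16)–(3.20) pp.268–269 (bookkeeping)] -/
theorem WtOfRecord₁₃H_rePinH_ζ_eq_zero_of_ne {n j : ℕ} (hj : j < p.K) (s : SeqOfRecord F θ.ν θ.τ9.M (gOfRecord₁₃ F N θ.toStage13Params p) p.K n)
    (hne : s.Ω (j + 1) ≠ ∅) (hnu : s.Ω (j + 1) ≠ Set.univ) (ω : MultiCfg (F.P p.K) (SU N) (FluctV N)) :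
    (WtOfRecord₁₃H F N (rePinH θ) p s).ζ j (s.Ω (j + 1))ᶜ ω = 0 := by
  rw [WtOfRecord₁₃H_rePinH_ζ]
  have hT : (s.Ω (j + 1))ᶜ ≠ Set.univ := fun h => hne (Set.compl_univ_iff.1 h)
  have h0 : (s.Ω (j + 1))ᶜ ≠ ∅ := fun h => hnu (Set.compl_empty_iff.1 h)
  by_cases h : j < p.K ∧ ∃ s' : SeqOfRecord F θ.ν θ.τ9.M (gOfRecord₁₃ F N θ.toStage13Params p) p.K (j + 1),
      IsNoExpHistAt (θ := θ.toStage13Params) (p := p) s.Ω s.Λ j s'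
  · obtain ⟨s', hs'⟩ := h.2
    exact ZhPinOfRecord₁₃_ζ0_of_hist_of_ne_of_ne hj hs' hT h0 ω
  · rw [ZhPinOfRecord₁₃_ζ0_of_not h]
    exact ZrOfRecord₁₃_ζ0_of_ne_of_ne hj hT h0 ω

/-- **AT A NO-EXPANSION GENERATION A NON-ZERO WEIGHT OF RECORD CHARGES THE OLD FRONT FACTOR** at the re-pinned parameter: if `Ω_{j+1}(s) = ∅` (`j + 1 ≤ n`, `j < K`) and
`ζ_j(T)(ω) ≠ 0`, then `χ_j` of the history's first `j` pairs does not vanish at `(ω j).1` (the certificate's `ζ0_j(T)` is `χ_j · w_j`).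
[cite: Balaban1988Convergent, (2.17)–(2.18) p.257, (3.16) p.268, (3.24) p.270] -/
theorem chiSeqOfRecord_ne_zero_of_WtOfRecord₁₃H_rePinH_ζ_ne_zero {n j : ℕ} (hjn : j + 1 ≤ n) (hj : j < p.K)
    (s : SeqOfRecord F θ.ν θ.τ9.M (gOfRecord₁₃ F N θ.toStage13Params p) p.K n) (hΩ : s.Ω (j + 1) = ∅) (ω : MultiCfg (F.P p.K) (SU N) (FluctV N))
    (hne : (WtOfRecord₁₃H F N (rePinH θ) p s).ζ j (s.Ω (j + 1))ᶜ ω ≠ 0) :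
    chiSeqOfRecord F N θ.ν θ.τ9.M (gOfRecord₁₃ F N θ.toStage13Params p) p.K j (s.restrict hjn).init (ω j).1 ≠ 0 := by
  rw [WtOfRecord₁₃H_rePinH_ζ, hΩ, Set.compl_empty,
    ZhPinOfRecord₁₃_ζ0_univ_of_hist hj (isNoExpHistAt_restrict (θ := θ.toStage13Params) (p := p) hjn s hΩ)] at hne
  exact left_ne_zero_of_mul hne

/-! ## §3  ★★★ 12a″'s reading-region law at the re-pinned parameter, on the cut selector, from [15]-solvability at every level -/

/-- **★★★ THE READING-REGION LAW OF THE RESIDUAL HOLDS AT THE RE-PINNED PARAMETER ON THE CUT SELECTOR, FROM [15]-SOLVABILITY AT EVERY LEVEL** (the row `hreg` of the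
no-expansion 𝐓-step faces, DISCHARGED at `rePinH θ`).  Selector: print's reading region `readSelOfSeq (suppDom Ω₁(s)) s.Ω j Y` at the 𝐓-step's own region arguments
`Y = (Ω_{j+1}(s))ᶜ`, `j < k`, and `∅` at every other `(j, Y)` (where no 𝐓-step of the history reads).  Proof: at an expansion generation the weight vanishes (§2); at a
no-expansion generation `j ≥ 1` a non-zero weight charges `χ_j` of the first `j` pairs (§2), and `…N11ChiTopRegularity`'s ★★★★ (χ_j ≠ 0 + per-cube [15]-solvability +
cube cover + numerics) gives `2ε_j ≤ cR·ε_j`-regularity on the plaquettes touching `Ω_j^{(j)} ⊇` the reading region; at `j = 0` a no-expansion first step has `Ω₁ = ∅`, so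
the support domain and the reading region are empty.  Rows: per-cube solvability inside `χ_j`, the cover of `Ω_j` by the χ-cubes it contains, and the numerics — at EVERY
level `1 ≤ j ≤ k` (K0 ∕ def-R rows, as p598649's at level `k`). [cite: Balaban1988Convergent, (2.2) p.255, (2.10) p.256, (2.16)–(2.17) p.257, (3.16) p.268, p.267; Balaban1985Variational, Thm 1 (7)–(8) pp.278–279; Balaban1985Averaging, Prop. 2 p.26] -/
theorem regOn_rePinH_cutSel_of_solvable {k : ℕ} (hkK : k ≤ p.K) (hkm : k ≤ (F.P p.K).m + (F.P p.K).K) (hcR : 2 ≤ θ.s2.cR) (hM : 1 ≤ θ.ν.M₁)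
    (h3 : ∀ j, 1 ≤ j → j ≤ k →
      3 * side (F.P p.K).L θ.ν.M₁ j ≤ cubeSide (F.P p.K).L θ.ν.M₂ (RkOfRecord (F.P p.K).L θ.ν.r (gOfRecord₁₃ F N θ.toStage13Params p j)) j)
    (hR : ∀ j, 1 ≤ j → j ≤ k → (F.P p.K).L ^ j + (((F.P p.K).d + 4) * (F.P p.K).L + 2) * (∑ l ∈ Finset.range j, (F.P p.K).L ^ l) + 2 ≤
      cubeSide (F.P p.K).L θ.ν.M₂ (RkOfRecord (F.P p.K).L θ.ν.r (gOfRecord₁₃ F N θ.toStage13Params p j)) j)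
    (hε : ∀ j, 1 ≤ j → j ≤ k → 0 < epsOfRecord θ.ν (gOfRecord₁₃ F N θ.toStage13Params p) j)
    (hε3 : ∀ j, 1 ≤ j → j ≤ k → (143 * (((((F.P p.K).d + 4 : ℕ) : ℝ)) ^ 2 / 4) ^ 2) * epsOfRecord θ.ν (gOfRecord₁₃ F N θ.toStage13Params p) j ≤ 1 / 3)
    (hε2 : ∀ j, 1 ≤ j → j ≤ k →
      2 * epsOfRecord θ.ν (gOfRecord₁₃ F N θ.toStage13Params p) j ≤ 2 * ExpMeanLog.deltaSU (Fin N) / ((((F.P p.K).d + 4) * (F.P p.K).L : ℕ) : ℝ) ^ 2)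
    (hsolv : ∀ j, 1 ≤ j → j ≤ k → ∀ (s : SeqOfRecord F θ.ν θ.τ9.M (gOfRecord₁₃ F N θ.toStage13Params p) p.K j) (V : GaugeField (F.P p.K) j (SU N)),
      chiSeqOfRecord F N θ.ν θ.τ9.M (gOfRecord₁₃ F N θ.toStage13Params p) p.K j s V ≠ 0 →
      ∀ a ∈ cubesIn (fun a : ↥(cubeIndices (F.P p.K) (cubeSide (F.P p.K).L θ.ν.M₂ (RkOfRecord (F.P p.K).L θ.ν.r (gOfRecord₁₃ F N θ.toStage13Params p j)) j)) =>
          cubeEnl (F.P p.K) (cubeSide (F.P p.K).L θ.ν.M₂ (RkOfRecord (F.P p.K).L θ.ν.r (gOfRecord₁₃ F N θ.toStage13Params p j)) j) a 0) (s.Ω j),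
        ∃ U₀, IsMinimizer (avOfRecord F N p.K) {U | PlaqSmall (θ.ν.εreg * (F.P p.K).eta j ^ 2) U}
          (Bj θ.ν.M₁ (cubeEnl (F.P p.K) (cubeSide (F.P p.K).L θ.ν.M₂ (RkOfRecord (F.P p.K).L θ.ν.r (gOfRecord₁₃ F N θ.toStage13Params p j)) j) a 4) j)
          (avgFamily (avOfRecord F N p.K) (qsstarGIter0 j V)) U₀)
    (hcov : ∀ j, 1 ≤ j → j ≤ k → ∀ s : SeqOfRecord F θ.ν θ.τ9.M (gOfRecord₁₃ F N θ.toStage13Params p) p.K j,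
      s.Ω j ⊆ ⋃ a ∈ cubesIn (fun a : ↥(cubeIndices (F.P p.K) (cubeSide (F.P p.K).L θ.ν.M₂ (RkOfRecord (F.P p.K).L θ.ν.r (gOfRecord₁₃ F N θ.toStage13Params p j)) j)) =>
          cubeEnl (F.P p.K) (cubeSide (F.P p.K).L θ.ν.M₂ (RkOfRecord (F.P p.K).L θ.ν.r (gOfRecord₁₃ F N θ.toStage13Params p j)) j) a 0) (s.Ω j),
        cubeEnl (F.P p.K) (cubeSide (F.P p.K).L θ.ν.M₂ (RkOfRecord (F.P p.K).L θ.ν.r (gOfRecord₁₃ F N θ.toStage13Params p j)) j) a 0)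
    (s₀ : SeqOfRecord F θ.ν θ.τ9.M (gOfRecord₁₃ F N θ.toStage13Params p) p.K k) :
    ((rePinH θ).zhAt p s₀).RegOn F N (FluctV N) θ.ν θ.s2.cR p (gOfRecord₁₃ F N θ.toStage13Params p)
      (fun j Y => {x | (j < k ∧ Y = (s₀.Ω (j + 1))ᶜ) ∧ x ∈ readSelOfSeq F p (suppDomOfRecord F θ.ν p.K s₀.Ω) s₀.Ω j Y}) := by
  intro j Y ω hne
  beta_reduce
  by_cases hc : j < k ∧ Y = (s₀.Ω (j + 1))ᶜ
  swap
  · exact plaqSmallOn_plaqsOf_pts_sep_of_not hc _ j _ _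
  obtain ⟨hjk, rfl⟩ := hc
  rw [sep_setOf_eq_of ⟨hjk, rfl⟩]
  have hjK : j < p.K := lt_of_lt_of_le hjk hkK
  have hne' : (WtOfRecord₁₃H F N (rePinH θ) p s₀).ζ j (s₀.Ω (j + 1))ᶜ ω ≠ 0 := hne
  -- the region argument: empty / the whole torus / a proper region
  by_cases hΩ : s₀.Ω (j + 1) = ∅
  swap
  · by_cases hu : s₀.Ω (j + 1) = Set.univ
    · -- `Y = Tᶜ = ∅`: the reading region is empty
      rw [hu, Set.compl_univ]
      intro q hq
      have hsub : readSelOfSeq F p (suppDomOfRecord F θ.ν p.K s₀.Ω) s₀.Ω j ∅ ⊆ ∅ := readSelOfSeq_subset _ _ j ∅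
      rcases hq with h | h | h | h <;> exact absurd (hsub (mem_pts.1 h)) (Set.notMem_empty _)
    · exact absurd (WtOfRecord₁₃H_rePinH_ζ_eq_zero_of_ne θ p hjK s₀ hΩ hu ω) hne'
  -- no expansion at step `j+1`
  rw [hΩ, Set.compl_empty]
  rcases Nat.eq_zero_or_pos j with rfl | hj1
  · -- `j = 0`: `Ω₁ = ∅`, the support domain is empty
    rw [readSelOfSeq, if_pos rfl, suppDomOfRecord_eq_empty_of_Ω_one (F := F) θ.ν p.K s₀.Ω hΩ, Set.inter_empty]
    exact plaqSmallOn_plaqsOf_pts_empty 0 _ _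
  · -- `1 ≤ j < k`: the reading region is `Ω_j`, and `χ_j ≠ 0` on the first `j` pairs gives the top clause at level `j`
    have hjn : j + 1 ≤ k := hjk
    have hχ := chiSeqOfRecord_ne_zero_of_WtOfRecord₁₃H_rePinH_ζ_ne_zero θ p hjn hjK s₀ hΩ ω hne'
    have hΩj : (s₀.restrict hjn).init.Ω j = s₀.Ω j := by
      rw [Seq.init_Ω _ hj1 le_rfl, Seq.restrict_Ω hjn s₀ hj1 (Nat.le_succ j)]
    have htop := plaqSmallOn_genSet_top_of_chiSeqOfRecord_ne_zero_of_solvable (F := F) (N := N) θ.ν θ.τ9.M (gOfRecord₁₃ F N θ.toStage13Params p) p.K j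
      (hjk.le.trans hkm) (s₀.restrict hjn).init (ω j).1 hχ hM (h3 j hj1 hjk.le) (hR j hj1 hjk.le) (hε j hj1 hjk.le) (hε3 j hj1 hjk.le) (hε2 j hj1 hjk.le)
      (hsolv j hj1 hjk.le _ _ hχ) (hcov j hj1 hjk.le _)
    have hgen : genSet (s₀.restrict hjn).init.Ω j j = pts j (s₀.Ω j) := by
      show pts j (gammaRegion (s₀.restrict hjn).init.Ω j j) = _
      rw [gammaRegion_self _ j, hΩj]
    rw [hgen] at htop
    have hread : readSelOfSeq F p (suppDomOfRecord F θ.ν p.K s₀.Ω) s₀.Ω j Set.univ = s₀.Ω j := by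
      rw [readSelOfSeq, if_neg (Nat.pos_iff_ne_zero.mp hj1), Set.univ_inter]
    rw [hread]
    intro q hq
    exact (htop q hq).trans_le (mul_le_mul_of_nonneg_right hcR (hε j hj1 hjk.le).le)

end RePin

end Summit.QuantumFields.YangMills.Theorems.BalabanUVNodesN11ReadRegRePinned

end
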